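import Summits.Ventures.Crystal3D.StickySpheres.EightCensusSort
import Summits.Ventures.Crystal3D.StickySpheres.ContactEight
import Summits.Ventures.Crystal3D.StickySpheres.BipyrCap
import Summits.Ventures.Crystal3D.StickySpheres.Open8C
import Summits.Ventures.Crystal3D.StickySpheres.Open8D
import Summits.Ventures.Crystal3D.StickySpheres.Open8F
import Summits.Ventures.Crystal3D.StickySpheres.Open8I
import Summits.Ventures.Crystal3D.StickySpheres.Open8J
import Summits.Ventures.Crystal3D.StickySpheres.Open8M
import Summits.Ventures.Crystal3D.StickySpheres.Open8N
import Summits.Ventures.Crystal3D.StickySpheres.Open8R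
import Summits.Ventures.Crystal3D.StickySpheres.Open8T
import Summits.Ventures.Crystal3D.StickySpheres.Open8V
import Summits.Ventures.Crystal3D.StickySpheres.Open8W
import Summits.Ventures.Crystal3D.StickySpheres.Open8X
import Summits.Ventures.Crystal3D.StickySpheres.Open8Y
import Mathlib.Data.List.GetD
import HarnessLib

/-!
# The eight-ball census, minimum degree four: an 18-contact graph with all degrees `≥ 4` is the snub disphenoid

Venture `Crystal3D` (cell `pub-crystal3d`, seat p2). ENUM-A(c) of `ineq/FORMAL-C9.md`, geometric side. From the kernel search
`EightCensus.exists_patternC` and the pattern refutations (`no_BipyrCap`, `no_Open8C` … `no_Open8Y`, the `K_{3,3}` / `K_{2,6}`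
filters): if a graph `G` on `Fin 8` with exactly `18` edges and minimum degree `≥ 4` is relaxed-realised by unit balls in `ℝ³`,
then `G` contains (hence, having 18 edges, is) a labelled copy of the snub-disphenoid graph `EightCensus.snubEdges` (the contact
graph of the realised cluster n8-0002). The refutation of the one remaining open pattern `Open8L` (graph6 `GEnb~g`, `K₄`-free)
enters as an explicit HYPOTHESIS `hL` (its statement verbatim); the theorem is unconditional once `no_Open8L` lands.

Steps: a vertex of degree `4` ↦ `7` with neighbours `3,4,5,6` (`exists_relabel`); block permutations sorting the degrees on
`{0,1,2}` and on `{3,4,5,6}` (`exists_blockSort` of `EightCensusSort`); the missing-slot set `M` and its per-vertex counts;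
the search `EightCensus.exists_patternC`; the dispatch of the five pattern kinds.

HONEST FRAMING: finite combinatorics plus the cell's pattern lemmas; conditional on `hL` as stated; nothing about
crystallization.
-/

noncomputable section

open Finset

namespace Summit.Ventures.Crystal3D

namespace EightCensus

open EightSearch SimpleGraph

/-! ### The census theorem for minimum degree four -/

/-- **Eight balls, 18 contacts, all degrees `≥ 4` ⇒ snub disphenoid** (conditional on the hypothesis `hL` = refutation of `Open8L`). If a graph on `Fin 8` with
exactly `18` edges and minimum degree `≥ 4` is relaxed-realisable in `ℝ³`, it contains a labelled copy of `snubEdges`. [folklore] -/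
theorem eight_census_minDeg_four
    (hL : ∀ p : Fin 8 → EuclideanSpace ℝ (Fin 3), (∀ e ∈ Open8LEdges, dist (p e.1) (p e.2) = 1) →
      (∀ i j : Fin 8, i ≠ j → 1 ≤ dist (p i) (p j)) → False)
    (G : SimpleGraph (Fin 8)) [DecidableRel G.Adj]
    (hcard : G.edgeFinset.card = 18) (hdeg : ∀ i, 4 ≤ G.degree i) (hreal : RelaxedRealisable G) :
    ∃ f : Fin 8 → Fin 8, Function.Injective f ∧ ∀ e ∈ snubEdges, G.Adj (f e.1) (f e.2) := by
  -- 1. a vertex of degree exactly 4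
  obtain ⟨w, hw⟩ : ∃ w, G.degree w = 4 := by
    by_contra hno
    push Not at hno
    have h5 : ∀ v, 5 ≤ G.degree v := fun v => by have h1 := hdeg v; have h2 := hno v; omega
    have hsum := G.sum_degrees_eq_twice_card_edges
    rw [hcard] at hsum
    have h40 : 40 ≤ ∑ v, G.degree v :=
      calc (40 : ℕ) = ∑ _v : Fin 8, 5 := by simp
        _ ≤ ∑ v, G.degree v := Finset.sum_le_sum fun v _ => h5 v
    omega
  -- 2. relabel: `7 ↦ w`, neighbours at `3,4,5,6`, then sort the degrees inside the two blocks
  obtain ⟨g, hg7, hgN⟩ := exists_relabel G w hw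
  set D : Fin 8 → Fin 8 := fun j => ⟨G.degree (g j), by
    have := G.degree_lt_card_verts (g j); simpa using this⟩ with hD
  obtain ⟨σ, hσi, hσ7, hσb, s01, s12, s34, s45, s56⟩ := exists_blockSort D
  have hρi : Function.Injective (fun j => g (σ j)) := g.injective.comp hσi
  set ρ : Fin 8 ≃ Fin 8 := Equiv.ofBijective (fun j => g (σ j)) (Finite.injective_iff_bijective.mp hρi) with hρ
  have hρapp : ∀ j, ρ j = g (σ j) := fun j => rfl
  have hρ7 : ρ 7 = w := by rw [hρapp, hσ7, hg7]
  set G' : SimpleGraph (Fin 8) := G.comap ρ with hG'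
  have hadj' : ∀ i j, G'.Adj i j ↔ G.Adj (ρ i) (ρ j) := fun i j => Iff.rfl
  have hcard' : G'.edgeFinset.card = 18 := by rw [(SimpleGraph.Iso.comap ρ G).card_edgeFinset_eq, hcard]
  have hdeg' : ∀ j, G'.degree j = G.degree (ρ j) := fun j => ((SimpleGraph.Iso.comap ρ G).degree_eq j).symm
  obtain ⟨x, hxe, hxs⟩ := RelaxedRealisable.of_le_comap (G := G) (H := G') ρ ρ.injective le_rfl hreal
  -- 3. the missing slots
  set NC : Finset (Fin 8 × Fin 8) := univ.filter fun p => p.1 < p.2 ∧ ¬ G'.Adj p.1 p.2 with hNC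
  set M : Finset ℕ := NC.image fun p => pidx p.1 p.2 with hMdef
  have hLT : (univ.filter fun p : Fin 8 × Fin 8 => p.1 < p.2).card = 28 := by decide
  have hAC := card_filter_lt_adj G'
  rw [hcard'] at hAC
  have hunion : (univ.filter fun p : Fin 8 × Fin 8 => p.1 < p.2 ∧ G'.Adj p.1 p.2) ∪ NC =
      univ.filter fun p : Fin 8 × Fin 8 => p.1 < p.2 := by
    ext p; simp only [mem_union, hNC, mem_filter, mem_univ, true_and]; tauto
  have hdisj : Disjoint (univ.filter fun p : Fin 8 × Fin 8 => p.1 < p.2 ∧ G'.Adj p.1 p.2) NC := by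
    rw [Finset.disjoint_left]; intro p hp hq
    rw [mem_filter] at hp; rw [hNC, mem_filter] at hq; exact hq.2.2 hp.2.2
  have hNCcard : NC.card = 10 := by
    have h := card_union_of_disjoint hdisj; rw [hunion, hLT, hAC] at h; omega
  have hMcard : M.card = 10 := by
    rw [hMdef, card_image_of_injOn, hNCcard]
    intro p hp q hq hpq
    rw [mem_coe, hNC, mem_filter] at hp hq
    have h := pidx_inj p.1 p.2 q.1 q.2 hp.2.1 hq.2.1 hpq
    exact Prod.ext h.1 h.2
  -- membership in `M` = non-adjacency
  have hMiff : ∀ a b : Fin 8, a ≠ b → (pidx a b ∈ M ↔ ¬ G'.Adj a b) := by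
    intro a b hab
    constructor
    · intro hm hadj
      obtain ⟨p, hp, hpe⟩ := mem_image.1 hm
      rw [hNC, mem_filter] at hp
      rcases pidx_eq_cases p.1 p.2 a b hp.2.1 hab hpe with ⟨rfl, rfl⟩ | ⟨rfl, rfl⟩
      · exact hp.2.2 hadj
      · exact hp.2.2 hadj.symm
    · intro hna
      rcases lt_or_gt_of_ne hab with hlt | hlt
      · exact mem_image.2 ⟨(a, b), by rw [hNC, mem_filter]; exact ⟨mem_univ _, hlt, hna⟩, rfl⟩
      · refine mem_image.2 ⟨(b, a), by rw [hNC, mem_filter]; exact ⟨mem_univ _, hlt, fun h => hna h.symm⟩, ?_⟩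
        exact pidx_comm b a
  -- the slots at vertex `7`
  have h7adj : ∀ j : Fin 8, j ≠ 7 → (G'.Adj j 7 ↔ 3 ≤ j.val) := by
    intro j hj
    rw [hadj', hρ7, G.adj_comm]
    have hσj7 : σ j ≠ 7 := fun h => hj (hσi (h.trans hσ7.symm))
    rw [hρapp j, hgN (σ j) hσj7]
    have hj7 : j.val < 7 := by
      have := j.isLt
      have : j.val ≠ 7 := fun h => hj (Fin.ext h)
      omega
    exact hσb j hj7
  have hM : ∀ i ∈ M, i < 21 ∨ i = 21 ∨ i = 22 ∨ i = 23 := by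
    intro i hi
    obtain ⟨p, hp, rfl⟩ := mem_image.1 hi
    rw [hNC, mem_filter] at hp
    obtain ⟨-, hlt, hna⟩ := hp
    have hne : p.1 ≠ p.2 := ne_of_lt hlt
    by_cases h2 : p.2 = 7
    · have h1 : p.1 ≠ 7 := fun h => hne (h.trans h2.symm)
      rw [h2] at hna
      have hlt3 : p.1.val < 3 := by
        by_contra h
        exact hna ((h7adj p.1 h1).2 (by omega))
      rw [h2, pidx_comm, pidx_seven p.1 h1]
      omega
    · have h1 : p.1 ≠ 7 := by
        intro h
        have := p.2.isLt
        have h' : p.1.val < p.2.val := hlt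
        rw [h] at h'
        simp at h'
        omega
      exact Or.inl ((pidx_lt_twentyone p.1 p.2 hne).2 ⟨h1, h2⟩)
  have hbase : ∀ a : Fin 8, a.val < 3 → pidx a 7 ∈ M := by
    intro a ha
    have ha7 : a ≠ 7 := by intro h; rw [h] at ha; simp at ha
    rw [hMiff a 7 ha7]
    intro h
    have := (h7adj a ha7).1 h
    omega
  have h21 : 21 ∈ M := by simpa [show pidx 0 7 = 21 by decide] using hbase 0 (by decide)
  have h22 : 22 ∈ M := by simpa [show pidx 1 7 = 22 by decide] using hbase 1 (by decide)
  have h23 : 23 ∈ M := by simpa [show pidx 2 7 = 23 by decide] using hbase 2 (by decide)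
  -- 4. missing counts per vertex = 7 − degree
  have hcount : ∀ v : Fin 8, (M.filter fun i => ∃ u : V, u ≠ v ∧ pidx u v = i).card + G'.degree v = 7 := by
    intro v
    set A : Finset (Fin 8) := univ.filter fun u => u ≠ v ∧ ¬ G'.Adj v u with hA
    have hAB : A.card + G'.degree v = 7 := by
      rw [← SimpleGraph.card_neighborFinset_eq_degree]
      have hu : A ∪ G'.neighborFinset v = univ.erase v := by
        ext u
        simp only [hA, mem_union, mem_filter, mem_univ, true_and, SimpleGraph.mem_neighborFinset, mem_erase]
        constructor
        · rintro (⟨huv, _⟩ | h)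
          · exact ⟨huv, trivial⟩
          · exact ⟨(G'.ne_of_adj h).symm, trivial⟩
        · rintro ⟨huv, -⟩
          by_cases h : G'.Adj v u
          · exact Or.inr h
          · exact Or.inl ⟨huv, h⟩
      have hd : Disjoint A (G'.neighborFinset v) := by
        rw [Finset.disjoint_left]; intro u hu hu'
        rw [hA, mem_filter] at hu; rw [SimpleGraph.mem_neighborFinset] at hu'; exact hu.2.2 hu'
      have := card_union_of_disjoint hd
      rw [hu, card_erase_of_mem (mem_univ v), card_univ, Fintype.card_fin] at this
      omega
    have himg : (M.filter fun i => ∃ u : V, u ≠ v ∧ pidx u v = i) = A.image fun u => pidx u v := by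
      ext i
      simp only [mem_filter, mem_image, hA, mem_univ, true_and]
      constructor
      · rintro ⟨hiM, u, huv, rfl⟩
        refine ⟨u, ⟨huv, fun h => ?_⟩, rfl⟩
        exact ((hMiff u v huv).1 hiM) h.symm
      · rintro ⟨u, ⟨huv, hna⟩, rfl⟩
        exact ⟨(hMiff u v huv).2 (fun h => hna h.symm), u, huv, rfl⟩
    rw [himg, card_image_of_injOn]
    · exact hAB
    · intro u hu u' hu' h
      rw [mem_coe, hA, mem_filter] at hu hu'
      exact pidx_left_inj v u u' hu.2.1 hu'.2.1 h
  have hdeg7 : ∀ v : Fin 8, (M.filter fun i => ∃ u : V, u ≠ v ∧ pidx u v = i).card = 7 - G'.degree v := by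
    intro v; have := hcount v; omega
  -- degrees along `ρ`: `G'.degree j = D (σ j)`
  have hdegD : ∀ j, G'.degree j = (D (σ j)).val := by
    intro j; rw [hdeg' j, hρapp j]
  have hdegG : ∀ j, 4 ≤ G'.degree j := fun j => by rw [hdeg' j]; exact hdeg _
  have hs01 : G'.degree 0 ≤ G'.degree 1 := by rw [hdegD, hdegD]; exact s01
  have hs12 : G'.degree 1 ≤ G'.degree 2 := by rw [hdegD, hdegD]; exact s12
  have hs34 : G'.degree 3 ≤ G'.degree 4 := by rw [hdegD, hdegD]; exact s34
  have hs45 : G'.degree 4 ≤ G'.degree 5 := by rw [hdegD, hdegD]; exact s45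
  have hs56 : G'.degree 5 ≤ G'.degree 6 := by rw [hdegD, hdegD]; exact s56
  have hle7 : ∀ j, G'.degree j ≤ 7 := fun j => by have := hcount j; omega
  -- 5. the search
  obtain ⟨p, hp, hcases⟩ := exists_patternC M hM h21 h22 h23 hMcard
    (fun v => by rw [hdeg7]; have := hdegG v; omega)
    (by
      simp only [hdeg7]
      have := hle7 0; have := hle7 1; have := hle7 2; have := hle7 3; have := hle7 4; have := hle7 5; have := hle7 6
      omega)
  have hv := cpatList_valid p hp
  have htm := cpatList_tmap p hp
  clear hp
  have hv1 : ∀ e ∈ p.edges, e.1 ≠ e.2 := fun e he => hv.1 e (List.mem_append_left _ he)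
  have hv2 : ∀ e ∈ p.non, e.1 ≠ e.2 := fun e he => hv.1 e (List.mem_append_right _ he)
  have hcon : ∀ a b : Fin 8, a ≠ b → pidx a b ∉ M → dist (x a) (x b) = 1 := by
    intro a b hab hS
    have hadj : G'.Adj a b := by
      by_contra hna; exact hS ((hMiff a b hab).2 hna)
    exact hxe a b hadj
  have hy : IsUnitPacking x := fun i j hij => hxs i j hij
  rcases hcases with ⟨hgood, hmask⟩ | ⟨hbad, hfree⟩
  · -- the good case: a labelled snub disphenoid
    cases p with
    | k33 t => exact absurd hgood (by simp [CPat.good])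
    | k26 t => exact absurd hgood (by simp [CPat.good])
    | bipyr t => exact absurd hgood (by simp [CPat.good])
    | open8 l t => exact absurd hgood (by simp [CPat.good])
    | snub t =>
      obtain ⟨hnd, hlen⟩ := htm
      simp only [CPat.tmap, CPat.tlen] at hnd hlen
      have hlen8 : 8 ≤ t.length := le_of_eq hlen.symm
      refine ⟨fun i => ρ (app t i), ρ.injective.comp (app_injective hnd hlen8), fun e he => ?_⟩
      rw [← hadj']
      have hne : app (k := 8) t e.1 ≠ app t e.2 := by
        have h := hv1 _ (mem_relabel t he)
        simpa using h
      by_contra hna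
      have hm : pidx (app (k := 8) t e.1) (app t e.2) ∈ M := (hMiff _ _ hne).2 hna
      have hb1 := testBit_maskOf (mem_relabel (k := 8) t he)
      simp only [CPat.edges] at hmask
      rw [hmask, Nat.testBit_xor, testBit_ALL28 _ _ hne, SevenSearch.testBit_sum_two_pow_of_mem hm] at hb1
      simp at hb1
  · -- the bad cases: each is refuted
    exfalso
    have H1 : ∀ e ∈ p.edges, dist (x e.1) (x e.2) = 1 := fun e he => hcon _ _ (hv1 e he) (hfree e he)
    have H2 : ∀ e ∈ p.non, 1 ≤ dist (x e.1) (x e.2) := fun e he => hxs _ _ (hv2 e he)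
    cases p with
    | snub t => exact absurd hbad (by simp [CPat.good])
    | k33 t =>
      obtain ⟨a, b, c, d, e, f⟩ := t
      simp only [CPat.edges, CPat.non, k33Edges, k33Non, List.forall_mem_cons, List.not_mem_nil, false_implies,
        implies_true, and_true] at H1 hv1 hv2
      obtain ⟨had, hae, haf, hbd, hbe, hbf, hcd, hce, hcf⟩ := H1
      obtain ⟨nad, nae, naf, nbd, nbe, nbf, ncd, nce, ncf⟩ := hv1
      obtain ⟨nab, nac, nbc, nde, ndf, nef⟩ := hv2
      have hsub : ({d, e, f} : Finset (Fin 8)) ⊆ contactNeighbors x a ∩ contactNeighbors x b ∩ contactNeighbors x c := by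
        intro j hj
        simp only [mem_insert, mem_singleton] at hj
        simp only [mem_inter, mem_contactNeighbors]
        rcases hj with rfl | rfl | rfl
        · exact ⟨⟨⟨nad.symm, had⟩, nbd.symm, hbd⟩, ncd.symm, hcd⟩
        · exact ⟨⟨⟨nae.symm, hae⟩, nbe.symm, hbe⟩, nce.symm, hce⟩
        · exact ⟨⟨⟨naf.symm, haf⟩, nbf.symm, hbf⟩, ncf.symm, hcf⟩
      have h3 : ({d, e, f} : Finset (Fin 8)).card = 3 := by
        rw [card_insert_of_notMem (by simp [nde, ndf]), card_pair nef]
      have h2 := card_common_contactNeighbors_three_le_two' hy nab nac nbc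
      have h3' := card_le_card hsub
      rw [h3] at h3'
      omega
    | k26 t =>
      obtain ⟨p, q, a, b, c, d, e, f⟩ := t
      simp only [CPat.edges, CPat.non, k26Edges, k26Non, List.forall_mem_cons, List.not_mem_nil, false_implies,
        implies_true, and_true] at H1 hv1 hv2
      obtain ⟨hpa, hpb, hpc, hpd, hpe, hpf, hqa, hqb, hqc, hqd, hqe, hqf⟩ := H1
      obtain ⟨npa, npb, npc, npd, npe, npf, nqa, nqb, nqc, nqd, nqe, nqf⟩ := hv1
      obtain ⟨npq, nab, nac, nad, nae, naf, nbc, nbd, nbe, nbf, ncd, nce, ncf, nde, ndf, nef⟩ := hv2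
      have hsub : ({a, b, c, d, e, f} : Finset (Fin 8)) ⊆ contactNeighbors x p ∩ contactNeighbors x q := by
        intro j hj
        simp only [mem_insert, mem_singleton] at hj
        simp only [mem_inter, mem_contactNeighbors]
        rcases hj with rfl | rfl | rfl | rfl | rfl | rfl
        · exact ⟨⟨npa.symm, hpa⟩, nqa.symm, hqa⟩
        · exact ⟨⟨npb.symm, hpb⟩, nqb.symm, hqb⟩
        · exact ⟨⟨npc.symm, hpc⟩, nqc.symm, hqc⟩
        · exact ⟨⟨npd.symm, hpd⟩, nqd.symm, hqd⟩
        · exact ⟨⟨npe.symm, hpe⟩, nqe.symm, hqe⟩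
        · exact ⟨⟨npf.symm, hpf⟩, nqf.symm, hqf⟩
      have h6 : ({a, b, c, d, e, f} : Finset (Fin 8)).card = 6 := by
        rw [card_insert_of_notMem (by simp [nab, nac, nad, nae, naf]),
          card_insert_of_notMem (by simp [nbc, nbd, nbe, nbf]), card_insert_of_notMem (by simp [ncd, nce, ncf]),
          card_insert_of_notMem (by simp [nde, ndf]), card_pair nef]
      have h5 := card_common_contactNeighbors_le_five' hy npq
      have h6' := card_le_card hsub
      rw [h6] at h6'
      omega
    | bipyr t =>
      obtain ⟨hnd, hlen⟩ := htm
      simp only [CPat.tmap, CPat.tlen] at hnd hlen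
      have hlen6 : 6 ≤ t.length := le_of_eq hlen.symm
      have hinj := app_injective (k := 6) hnd hlen6
      have hE : ∀ e ∈ BipyrCapEdges, dist (x (app (k := 6) t e.1)) (x (app t e.2)) = 1 :=
        fun e he => H1 (app t e.1, app t e.2) (mem_relabel t he)
      exact no_BipyrCap (fun i => x (app t i)) hE (fun i j hij => hxs _ _ (hinj.ne hij))
    | open8 l t =>
      obtain ⟨hnd, hlen⟩ := htm
      simp only [CPat.tmap, CPat.tlen] at hnd hlen
      have hlen8 : 8 ≤ t.length := le_of_eq hlen.symm
      have hinj := app_injective (k := 8) hnd hlen8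
      have hE : ∀ e ∈ l.edges, dist (x (app (k := 8) t e.1)) (x (app t e.2)) = 1 :=
        fun e he => H1 (app t e.1, app t e.2) (mem_relabel t he)
      have hN : ∀ i j : Fin 8, i ≠ j → 1 ≤ dist (x (app (k := 8) t i)) (x (app t j)) := fun i j hij => hxs _ _ (hinj.ne hij)
      cases l with
      | oC => exact no_Open8C (fun i => x (app t i)) hE hN
      | oD => exact no_Open8D (fun i => x (app t i)) hE hN
      | oF => exact no_Open8F (fun i => x (app t i)) hE hN
      | oI => exact no_Open8I (fun i => x (app t i)) hE hN
      | oJ => exact no_Open8J (fun i => x (app t i)) hE hN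
      | oL => exact hL (fun i => x (app t i)) hE hN
      | oM => exact no_Open8M (fun i => x (app t i)) hE hN
      | oN => exact no_Open8N (fun i => x (app t i)) hE hN
      | oR => exact no_Open8R (fun i => x (app t i)) hE hN
      | oT => exact no_Open8T (fun i => x (app t i)) hE hN
      | oV => exact no_Open8V (fun i => x (app t i)) hE hN
      | oW => exact no_Open8W (fun i => x (app t i)) hE hN
      | oX => exact no_Open8X (fun i => x (app t i)) hE hN
      | oY => exact no_Open8Y (fun i => x (app t i)) hE hN


end EightCensus

end Summit.Ventures.Crystal3D

end
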